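import Summits.AtomisticToContinuum.Crystallization.Theses.TwoCentreKissingKernel

/-!
# Route `TwoCentreKissingKernel`, item stmt-AtomisticToContinuum-12081 `SoftTwoCentreFourCommon` —
# coordinate normal form (certificate interface)

`softTwoCentreFourCommon_of_normalForm` reduces the soft two-centre lemma to four explicitly
coordinatised finite infeasibility problems `P(c)`, `c = 0, 1, 2, 3` (the number of soft-common
neighbours of a would-be counterexample), stated for indexed families of points of `ℝ³`:

* the two centres are `z = 0` and `z' = (0, 0, t)` with `1 - η ≤ t ≤ 1 + η`;
* `w : Fin c → ℝ³` are the soft-common neighbours (within `1 + η` of both centres),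
  `a : Fin (11 - c) → ℝ³` the exclusive soft neighbours of `z` (farther than `1 + η` from `z'`),
  `b : Fin (11 - c) → ℝ³` the exclusive soft neighbours of `z'`;
* all `22 - c` points are pairwise `(1 - η)`-separated and at distance `≥ 1 - η` from the centre(s)
  they neighbour;
* azimuthal gauge: the first exclusive neighbour `a 0` lies in the closed half-plane
  `{x₁ = 0, x₀ ≥ 0}`.

The reduction is bookkeeping (the twelve-point soft shell of `z` is `{z'} ⊔ common ⊔ exclusive`,
so `#exclusive = 11 - c`) plus a rigid motion: a translation and two hyperplane reflections
(`Submodule.reflection_sub`) move `z ↦ 0`, `z' ↦ t·e₂` and the gauge point into the half-plane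
(`exists_dist_preserving_normalForm`).  These `P(c)` — compact configuration spaces of dimension
`3(22 - c) - 1` before using the sphere constraints, numerically infeasible with min-distance
deficits ≈ 2.0 % (`c = 3`), 3.3 %, 5.8 %, 7.3 % (`c = 2, 1, 0`) at `η = 10⁻³` (kit j016614 of
seat 12081-0) — are the exact input of any interval / SDP certificate for the item; nothing here
proves the item itself (its `η = 0` section is Flatley–Theil's Conjecture 2.2, crux 12077).
-/

namespace Summit.AtomisticToContinuum.Crystallization.Theorems

open Summit.AtomisticToContinuum.Crystallization.Theses.TwoCentreKissingKernel

open scoped Classical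

/-- **Rigid-motion normal form.**  For any three points `z, z', p` of `ℝ³` there is a
distance-preserving map `Φ` with `Φ z = 0`, `Φ z' = (0, 0, dist z z')` and `Φ p` in the closed
half-plane `{x₁ = 0, x₀ ≥ 0}`.  Construction: translate by `-z`, reflect `z' - z` onto the
positive `x₂`-axis (`Submodule.reflection_sub`), then reflect in a hyperplane containing the
`x₂`-axis to kill the `x₁`-coordinate of the image of `p`. -/
theorem exists_dist_preserving_normalForm (z z' p : EuclideanSpace ℝ (Fin 3)) :
    ∃ Φ : EuclideanSpace ℝ (Fin 3) → EuclideanSpace ℝ (Fin 3),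
      (∀ x y, dist (Φ x) (Φ y) = dist x y) ∧ Φ z = 0 ∧
      Φ z' = EuclideanSpace.single 2 (dist z z') ∧ Φ p 1 = 0 ∧ 0 ≤ Φ p 0 := by
  set t : ℝ := dist z z' with ht
  set v : EuclideanSpace ℝ (Fin 3) := z' - z with hv
  set e : EuclideanSpace ℝ (Fin 3) := EuclideanSpace.single 2 t with he
  have hnorm : ‖v‖ = ‖e‖ := by
    rw [he, PiLp.norm_single, Real.norm_of_nonneg dist_nonneg, hv, ← dist_eq_norm, dist_comm]
  set R₁ := (ℝ ∙ (v - e))ᗮ.reflection with hR₁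
  have hR₁v : R₁ v = e := Submodule.reflection_sub hnorm
  set q : EuclideanSpace ℝ (Fin 3) := R₁ (p - z) with hq
  set r : ℝ := Real.sqrt (q 0 ^ 2 + q 1 ^ 2) with hr
  set q' : EuclideanSpace ℝ (Fin 3) := EuclideanSpace.single 0 r + EuclideanSpace.single 2 (q 2)
    with hq'
  have hr0 : 0 ≤ r := Real.sqrt_nonneg _
  have hq'0 : q' 0 = r := by simp [hq']
  have hq'1 : q' 1 = 0 := by simp [hq']
  have hq'2 : q' 2 = q 2 := by simp [hq']
  have hqq' : ‖q‖ = ‖q'‖ := by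
    have h1 : ‖q‖ ^ 2 = ‖q'‖ ^ 2 := by
      rw [EuclideanSpace.norm_sq_eq, EuclideanSpace.norm_sq_eq, Fin.sum_univ_three,
        Fin.sum_univ_three]
      simp only [Real.norm_eq_abs, sq_abs, hq'0, hq'1, hq'2]
      rw [hr, Real.sq_sqrt (by positivity)]
      ring
    exact (sq_eq_sq₀ (norm_nonneg _) (norm_nonneg _)).1 h1
  set R₂ := (ℝ ∙ (q - q'))ᗮ.reflection with hR₂
  have hR₂q : R₂ q = q' := Submodule.reflection_sub hqq'
  have heK : e ∈ (ℝ ∙ (q - q'))ᗮ := by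
    rw [Submodule.mem_orthogonal_singleton_iff_inner_right, he, EuclideanSpace.inner_single_right]
    simp [hq'2]
  have hR₂e : R₂ e = e := Submodule.reflection_mem_subspace_eq_self heK
  refine ⟨fun x => R₂ (R₁ (x - z)), ?_, ?_, ?_, ?_, ?_⟩
  · intro x y
    rw [R₂.dist_map, R₁.dist_map, dist_sub_right]
  · simp
  · show R₂ (R₁ (z' - z)) = e
    rw [← hv, hR₁v, hR₂e]
  · show R₂ (R₁ (p - z)) 1 = 0
    rw [← hq, hR₂q, hq'1]
  · show 0 ≤ R₂ (R₁ (p - z)) 0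
    rw [← hq, hR₂q, hq'0]
    exact hr0

/-- **Coordinate normal form of `SoftTwoCentreFourCommon` (certificate interface).**
The soft two-centre lemma follows from the infeasibility, for every tolerance `η ∈ [0, 10⁻³]`,
every centre distance `t ∈ [1 - η, 1 + η]` and every `c ≤ 3`, of the configuration `P(c)`:
`c` soft-common points `w i` (norm and distance to `(0,0,t)` both in `[1 - η, 1 + η]`),
`11 - c` exclusive neighbours `a i` of `0` (norm in `[1 - η, 1 + η]`, distance to `(0,0,t)`
`> 1 + η`), `11 - c` exclusive neighbours `b i` of `(0,0,t)` (symmetrically), all pairwise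
`(1 - η)`-separated, with the gauge `(a 0)₁ = 0 ≤ (a 0)₀`.
Proof: in a counterexample the twelve-point soft shell of `z` is the disjoint union of `{z'}`,
the `c ≤ 3` common neighbours and the exclusive ones (so there are `11 - c ≥ 8` of the latter,
likewise for `z'`); enumerate the three finite sets and transport them by the rigid motion of
`exists_dist_preserving_normalForm` (gauge point: the first exclusive neighbour of `z`). -/
theorem softTwoCentreFourCommon_of_normalForm
    (H : ∀ η : ℝ, 0 ≤ η → η ≤ 1 / 1000 → ∀ t : ℝ, 1 - η ≤ t → t ≤ 1 + η → ∀ c : ℕ, c ≤ 3 →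
      ∀ (w : Fin c → EuclideanSpace ℝ (Fin 3)) (a b : Fin (11 - c) → EuclideanSpace ℝ (Fin 3)),
      (∀ i : Fin (11 - c), (i : ℕ) = 0 → a i 1 = 0 ∧ 0 ≤ a i 0) →
      (∀ i, 1 - η ≤ ‖w i‖ ∧ ‖w i‖ ≤ 1 + η ∧ 1 - η ≤ dist (w i) (EuclideanSpace.single 2 t) ∧
        dist (w i) (EuclideanSpace.single 2 t) ≤ 1 + η) →
      (∀ i, 1 - η ≤ ‖a i‖ ∧ ‖a i‖ ≤ 1 + η ∧ 1 + η < dist (a i) (EuclideanSpace.single 2 t)) →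
      (∀ i, 1 + η < ‖b i‖ ∧ 1 - η ≤ dist (b i) (EuclideanSpace.single 2 t) ∧
        dist (b i) (EuclideanSpace.single 2 t) ≤ 1 + η) →
      (∀ i j, i ≠ j → 1 - η ≤ dist (w i) (w j)) →
      (∀ i j, i ≠ j → 1 - η ≤ dist (a i) (a j)) →
      (∀ i j, i ≠ j → 1 - η ≤ dist (b i) (b j)) →
      (∀ i j, 1 - η ≤ dist (w i) (a j)) →
      (∀ i j, 1 - η ≤ dist (w i) (b j)) →
      (∀ i j, 1 - η ≤ dist (a i) (b j)) → False) :
    SoftTwoCentreFourCommon := by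
  intro η hη hη1 Z hsep z hz z' hz' hne hd hN hN'
  by_contra hlt
  rw [not_le] at hlt
  -- the five sets
  set Nz : Set (EuclideanSpace ℝ (Fin 3)) := {w ∈ Z | w ≠ z ∧ dist w z ≤ 1 + η} with hNz
  set Nz' : Set (EuclideanSpace ℝ (Fin 3)) := {w ∈ Z | w ≠ z' ∧ dist w z' ≤ 1 + η} with hNz'
  set Cm : Set (EuclideanSpace ℝ (Fin 3)) :=
    {w ∈ Z | w ≠ z ∧ w ≠ z' ∧ dist w z ≤ 1 + η ∧ dist w z' ≤ 1 + η} with hCm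
  set A : Set (EuclideanSpace ℝ (Fin 3)) :=
    {w ∈ Z | w ≠ z ∧ dist w z ≤ 1 + η ∧ 1 + η < dist w z'} with hA
  set B : Set (EuclideanSpace ℝ (Fin 3)) :=
    {w ∈ Z | w ≠ z' ∧ dist w z' ≤ 1 + η ∧ 1 + η < dist w z} with hB
  have hNzfin : Nz.Finite := Set.finite_of_ncard_ne_zero (by rw [hN]; norm_num)
  have hNz'fin : Nz'.Finite := Set.finite_of_ncard_ne_zero (by rw [hN']; norm_num)
  have hCsub : Cm ⊆ Nz := fun x ⟨hx, h1, _, h3, _⟩ => ⟨hx, h1, h3⟩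
  have hAsub : A ⊆ Nz := fun x ⟨hx, h1, h2, _⟩ => ⟨hx, h1, h2⟩
  have hBsub : B ⊆ Nz' := fun x ⟨hx, h1, h2, _⟩ => ⟨hx, h1, h2⟩
  have hCfin : Cm.Finite := hNzfin.subset hCsub
  have hAfin : A.Finite := hNzfin.subset hAsub
  have hBfin : B.Finite := hNz'fin.subset hBsub
  -- decompositions of the two shells
  have hdz : dist z' z ≤ 1 + η := by rwa [dist_comm]
  have eNz : Nz = insert z' (Cm ∪ A) := by
    ext x
    simp only [hNz, hCm, hA, Set.mem_insert_iff, Set.mem_union, Set.mem_setOf_eq]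
    constructor
    · rintro ⟨hx, h1, h2⟩
      by_cases hxz' : x = z'
      · exact Or.inl hxz'
      · by_cases hle : dist x z' ≤ 1 + η
        · exact Or.inr (Or.inl ⟨hx, h1, hxz', h2, hle⟩)
        · exact Or.inr (Or.inr ⟨hx, h1, h2, lt_of_not_ge hle⟩)
    · rintro (rfl | ⟨hx, h1, -, h3, -⟩ | ⟨hx, h1, h2, -⟩)
      · exact ⟨hz', hne.symm, hdz⟩
      · exact ⟨hx, h1, h3⟩
      · exact ⟨hx, h1, h2⟩
  have eNz' : Nz' = insert z (Cm ∪ B) := by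
    ext x
    simp only [hNz', hCm, hB, Set.mem_insert_iff, Set.mem_union, Set.mem_setOf_eq]
    constructor
    · rintro ⟨hx, h1, h2⟩
      by_cases hxz : x = z
      · exact Or.inl hxz
      · by_cases hle : dist x z ≤ 1 + η
        · exact Or.inr (Or.inl ⟨hx, hxz, h1, hle, h2⟩)
        · exact Or.inr (Or.inr ⟨hx, h1, h2, lt_of_not_ge hle⟩)
    · rintro (rfl | ⟨hx, -, h2, -, h4⟩ | ⟨hx, h1, h2, -⟩)
      · exact ⟨hz, hne, hd⟩
      · exact ⟨hx, h2, h4⟩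
      · exact ⟨hx, h1, h2⟩
  have hz'not : z' ∉ Cm ∪ A := by
    rintro (⟨-, -, h, -⟩ | ⟨-, -, -, h⟩)
    · exact h rfl
    · rw [dist_self] at h; linarith
  have hznot : z ∉ Cm ∪ B := by
    rintro (⟨-, h, -⟩ | ⟨-, -, -, h⟩)
    · exact h rfl
    · rw [dist_self] at h; linarith
  have hCA : Disjoint Cm A := by
    rw [Set.disjoint_left]
    rintro x ⟨-, -, -, -, h4⟩ ⟨-, -, -, h⟩
    linarith
  have hCB : Disjoint Cm B := by
    rw [Set.disjoint_left]
    rintro x ⟨-, -, -, h3, -⟩ ⟨-, -, -, h⟩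
    linarith
  have hcardA : Cm.ncard + A.ncard + 1 = 12 := by
    rw [← hN, eNz, Set.ncard_insert_of_notMem hz'not (hCfin.union hAfin),
      Set.ncard_union_eq hCA hCfin hAfin]
  have hcardB : Cm.ncard + B.ncard + 1 = 12 := by
    rw [← hN', eNz', Set.ncard_insert_of_notMem hznot (hCfin.union hBfin),
      Set.ncard_union_eq hCB hCfin hBfin]
  -- enumerations of the three finite sets
  obtain ⟨c, fC, hfC⟩ := hCfin.fin_embedding
  obtain ⟨nA, fA, hfA⟩ := hAfin.fin_embedding
  obtain ⟨nB, fB, hfB⟩ := hBfin.fin_embedding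
  have hcC : c = Cm.ncard := by
    rw [← hfC, Set.ncard_range_of_injective fC.injective, Nat.card_eq_fintype_card,
      Fintype.card_fin]
  have hnA : nA = A.ncard := by
    rw [← hfA, Set.ncard_range_of_injective fA.injective, Nat.card_eq_fintype_card,
      Fintype.card_fin]
  have hnB : nB = B.ncard := by
    rw [← hfB, Set.ncard_range_of_injective fB.injective, Nat.card_eq_fintype_card,
      Fintype.card_fin]
  have hc3 : c ≤ 3 := by omega
  have hA11 : nA = 11 - c := by omega
  have hB11 : nB = 11 - c := by omega
  subst hA11 hB11
  have h8 : 0 < 11 - c := by omega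
  have hwmem : ∀ i, fC i ∈ Cm := fun i => by rw [← hfC]; exact Set.mem_range_self i
  have hamem : ∀ i, fA i ∈ A := fun i => by rw [← hfA]; exact Set.mem_range_self i
  have hbmem : ∀ i, fB i ∈ B := fun i => by rw [← hfB]; exact Set.mem_range_self i
  -- the rigid motion
  obtain ⟨Φ, hΦd, hΦz, hΦz', hΦp1, hΦp0⟩ :=
    exists_dist_preserving_normalForm z z' (fA ⟨0, h8⟩)
  have hnormΦ : ∀ x, ‖Φ x‖ = dist x z := fun x => by
    rw [← dist_zero_right, ← hΦz, hΦd]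
  have hdistΦ : ∀ x, dist (Φ x) (EuclideanSpace.single 2 (dist z z')) = dist x z' := fun x => by
    rw [← hΦz', hΦd]
  have ht1 : 1 - η ≤ dist z z' := hsep z hz z' hz' hne
  refine H η hη hη1 (dist z z') ht1 hd c hc3 (fun i => Φ (fC i)) (fun i => Φ (fA i))
    (fun i => Φ (fB i)) ?_ ?_ ?_ ?_ ?_ ?_ ?_ ?_ ?_ ?_
  · intro i hi
    have : i = ⟨0, h8⟩ := Fin.ext hi
    subst this
    exact ⟨hΦp1, hΦp0⟩
  · intro i
    obtain ⟨hx, h1, h2, h3, h4⟩ := hwmem i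
    refine ⟨?_, ?_, ?_, ?_⟩
    · rw [hnormΦ]; exact hsep _ hx z hz h1
    · rw [hnormΦ]; exact h3
    · rw [hdistΦ]; exact hsep _ hx z' hz' h2
    · rw [hdistΦ]; exact h4
  · intro i
    obtain ⟨hx, h1, h2, h3⟩ := hamem i
    refine ⟨?_, ?_, ?_⟩
    · rw [hnormΦ]; exact hsep _ hx z hz h1
    · rw [hnormΦ]; exact h2
    · rw [hdistΦ]; exact h3
  · intro i
    obtain ⟨hx, h1, h2, h3⟩ := hbmem i
    refine ⟨?_, ?_, ?_⟩
    · rw [hnormΦ]; exact h3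
    · rw [hdistΦ]; exact hsep _ hx z' hz' h1
    · rw [hdistΦ]; exact h2
  · intro i j hij
    rw [hΦd]
    exact hsep _ (hwmem i).1 _ (hwmem j).1 (fun h => hij (fC.injective h))
  · intro i j hij
    rw [hΦd]
    exact hsep _ (hamem i).1 _ (hamem j).1 (fun h => hij (fA.injective h))
  · intro i j hij
    rw [hΦd]
    exact hsep _ (hbmem i).1 _ (hbmem j).1 (fun h => hij (fB.injective h))
  · intro i j
    rw [hΦd]
    refine hsep _ (hwmem i).1 _ (hamem j).1 ?_
    intro h
    have h4 := (hwmem i).2.2.2.2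
    have h3 := (hamem j).2.2.2
    rw [h] at h4
    linarith
  · intro i j
    rw [hΦd]
    refine hsep _ (hwmem i).1 _ (hbmem j).1 ?_
    intro h
    have h4 := (hwmem i).2.2.2.1
    have h3 := (hbmem j).2.2.2
    rw [h] at h4
    linarith
  · intro i j
    rw [hΦd]
    refine hsep _ (hamem i).1 _ (hbmem j).1 ?_
    intro h
    have h4 := (hamem i).2.2.1
    have h3 := (hbmem j).2.2.2
    rw [h] at h4
    linarith

end Summit.AtomisticToContinuum.Crystallization.Theorems
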